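import Mathlib
import HarnessLib
import Summits.HubbardSuperconductivity.HubbardSuperconductivity.Theorems.KLProgrammeKLRegimeSplitTwoLegCoreTDProfile
import Summits.HubbardSuperconductivity.HubbardSuperconductivity.Theorems.KLProgrammeKLRegimeTwoLegCurvatureDefs

/-!
# Route `KLProgramme` — GEN-6 ENGINE (`KLRegimeEngineV16`, stmt-HubbardSuperconductivity-20236), two-leg stubs (M)/(e): the PROFILE-KEYED
# `TwoLegCoreTD` closers with the angular jets DISCHARGED from the stub-6 predicate `TwoLegCurveJetBound` (plan g15 (R24) «C4a VISIBLE»)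

Cell `gate-hubbard-kl`, seat p1b (g8).  p517895 (`…TwoLegCoreTDProfile`) closes the core conjunct `TwoLegCoreTD … K 0 / (n+1)` of the two-leg
slot from the ANGULAR JETS `hA0/hA1/hA2` of the curve profile `δ_n`; p2 g10's `…TwoLegCurvatureDefs` (p517656) names that profile
(`klTwoLegCurveProfile L M β U μ K n`: `δ₀ = ν₀(K) − K∘k_F^K`, `δ_{n+1} = ν_{n+1}(K) − ν_n(K)`) and the predicate stub 6 concludes,
`TwoLegCurveJetBound L M cc cc' β U μ K n` (`C⁴` + `|δ_n^{(k)}| ≤ curveJetBar cc cc' U k n`, `k ≤ 4`, budget-parametric constants).  Here the two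
are joined at the `TwoLegCoreTD` level (r2d-p1's `…TwoLegStepSuccDoorProfile` p519360 does it for the (e) `TwoLegStepV16` door at `n + 1` only), so
that the (M) composition at `n = 0` and any other assembler have the same one-call shape:

* §1 `TwoLegCurveJetBound.jets_zero/jets_succ` — the three jets `k ≤ 2` in the closers' literal hypothesis shapes;
* §2 `twoLegCoreTD_zero/succ_of_curveJets` (named thresholds `klCurveC3 R`, `klCurveU0 R`, generic `G P Q`) and the registered-binder twins
  `twoLegCoreTD_zero/succ_of_curveJets_stub8` (`U ≤ klEngU₀4 P R c`, `klEngGeo5`, `klEngQ5 P R`): `A k := curveJetBar cc cc' U k n`; residuals = the fit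
  `hfitS` of those bars into `twoLegBar G Q U j n` (j ≤ 2), the (E3c) rows `hd/hnear/hvK'/hfitL/hfar`, the (E3e) rows `hz/hm₁'/hfit1`;
* §3 `twoLegCoreTD_zero_of_curveJetsAll[_stub8]` — at SCALE `0` the far value sizes `hvK'` of the comparison frames are themselves order-`0` jets:
  if the predicate holds at scale `0` for EVERY degree-capped frame (`hJall`; what stubs (a) + (6) give at `n = 0` for every `K′`, the history
  being empty there), `hvK'` is discharged too.  (At `n + 1` the comparison history `histV15` does not carry what stub 6's binders ask, so no
  such twin is offered there.)

Proofs only (compositions of landed theorems); no definitions; nothing about the model is asserted.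
References: BGM 2006 §2.4 (2.36) [cite: BenfattoGiulianiMastropietro2006]; KL STATUS l.2359 ((R24)), l.2398 (p1b g7), l.2409 (p2 g10), l.2439 (r2d-p1 g4).
-/

noncomputable section

namespace Summit.HubbardSuperconductivity.HubbardSuperconductivity.Theorems.KLRegimeSplit

set_option linter.dupNamespace false -- summit = problem name (single-conjunct summit), D-0017

open Real Finset
open Literature.MathematicalPhysics.QuantumLattice Literature.MathematicalPhysics.QuantumLattice.BandSectorCounting
open Literature.Probability.LatticeModels
open Summit.HubbardSuperconductivity.HubbardSuperconductivity.Theorems.DispersionFlow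
open Summit.HubbardSuperconductivity.HubbardSuperconductivity.Theorems.PerturbedFermiCurve
open Summit.HubbardSuperconductivity.HubbardSuperconductivity.Theorems.KLProgrammeLegKernels
open Summit.HubbardSuperconductivity.HubbardSuperconductivity.Theorems.EngineV8

variable {L M : ℕ} [NeZero L] [NeZero M]

/-! ## §1 The three jets `k ≤ 2` of the profile from the predicate, in the closers' hypothesis shapes -/

/-- **Scale `0`**: from `TwoLegCurveJetBound L M cc cc' β U μ K 0`, the value / slope / curvature of `θ ↦ ν₀(K)(θ) − K(k_F^K θ)` are within
`curveJetBar cc cc' U k 0`, `k = 0, 1, 2`. -/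
theorem TwoLegCurveJetBound.jets_zero {cc cc' : ℕ → ℝ} {β U μ : ℝ} {K : TrigPolyC4v} (hJ : TwoLegCurveJetBound L M cc cc' β U μ K 0) :
    (∀ θ : ℝ, |klLocalPart L M β U μ K 0 θ - K.eval (klFermiPoint μ K θ)| ≤ curveJetBar cc cc' U 0 0) ∧
      (∀ θ : ℝ, |deriv (fun θ => klLocalPart L M β U μ K 0 θ - K.eval (klFermiPoint μ K θ)) θ| ≤ curveJetBar cc cc' U 1 0) ∧
        ∀ θ : ℝ, |iteratedDeriv 2 (fun θ => klLocalPart L M β U μ K 0 θ - K.eval (klFermiPoint μ K θ)) θ| ≤ curveJetBar cc cc' U 2 0 := by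
  refine ⟨fun θ => ?_, fun θ => ?_, fun θ => ?_⟩
  · simpa only [klTwoLegCurveProfile_zero] using hJ.abs_le θ
  · simpa only [iteratedDeriv_one, klTwoLegCurveProfile_zero] using hJ.le (k := 1) (by norm_num) θ
  · simpa only [klTwoLegCurveProfile_zero] using hJ.le (k := 2) (by norm_num) θ

/-- **Scale `n + 1`**: from `TwoLegCurveJetBound L M cc cc' β U μ K (n+1)`, the value / slope / curvature of `θ ↦ ν_{n+1}(K)(θ) − ν_n(K)(θ)` are
within `curveJetBar cc cc' U k (n+1)`, `k = 0, 1, 2`. -/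
theorem TwoLegCurveJetBound.jets_succ {cc cc' : ℕ → ℝ} {β U μ : ℝ} {K : TrigPolyC4v} {n : ℕ}
    (hJ : TwoLegCurveJetBound L M cc cc' β U μ K (n + 1)) :
    (∀ θ : ℝ, |klLocalPart L M β U μ K (n + 1) θ - klLocalPart L M β U μ K n θ| ≤ curveJetBar cc cc' U 0 (n + 1)) ∧
      (∀ θ : ℝ, |deriv (fun θ => klLocalPart L M β U μ K (n + 1) θ - klLocalPart L M β U μ K n θ) θ| ≤
          curveJetBar cc cc' U 1 (n + 1)) ∧
        ∀ θ : ℝ, |iteratedDeriv 2 (fun θ => klLocalPart L M β U μ K (n + 1) θ - klLocalPart L M β U μ K n θ) θ| ≤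
          curveJetBar cc cc' U 2 (n + 1) := by
  refine ⟨fun θ => ?_, fun θ => ?_, fun θ => ?_⟩
  · simpa only [klTwoLegCurveProfile_succ] using hJ.abs_le θ
  · simpa only [iteratedDeriv_one, klTwoLegCurveProfile_succ] using hJ.le (k := 1) (by norm_num) θ
  · simpa only [klTwoLegCurveProfile_succ] using hJ.le (k := 2) (by norm_num) θ

/-! ## §2 The `TwoLegCoreTD` closers keyed on the predicate -/

/-- **`TwoLegCoreTD hist G P Q R … K 0` FROM THE SCALE-`0` CURVE-JET PREDICATE** (named thresholds): `hJ : TwoLegCurveJetBound L M cc cc' β U μ K 0`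
supplies the three jets; residuals = the fit `hfitS` of `curveJetBar cc cc' U k 0` (k ≤ 2) into `twoLegBar G Q U j 0`, the (E3c) rows and the (E3e) rows of
`twoLegCoreTD_zero_of_profileData`. -/
theorem twoLegCoreTD_zero_of_curveJets {R : RenConsts} (hR : ∀ j, 0 ≤ R.Gfr j) {c : ℝ} (hc : 0 < c)
    (hcle : c ≤ klCurveC3 R) {U : ℝ} (hU : 0 < U) (hUle : U ≤ klCurveU0 R) {β : ℝ} (hβmin : klBetaMin ≤ β)
    (hβc : β ≤ Real.exp (c / U ^ 2)) {μ : ℝ} (hμ : μ ∈ klWindowC) {K : TrigPolyC4v} (hKD : FrameOKDeg R U (nScales β) μ K)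
    (hL : klEngL₃ β U ≤ L) (hist : TrigPolyC4v → ℕ → Prop) (G : GeoConsts) (P : SplitConsts) (Q : EngConsts)
    {cc cc' : ℕ → ℝ} (hJ : TwoLegCurveJetBound L M cc cc' β U μ K 0)
    (hfitS : ∀ j ≤ 2, (if j = 0 then curveJetBar cc cc' U 0 0 else 0) +
      (j.factorial : ℝ) ^ 2 * (2 * j.factorial * 1110 * 200 ^ j) *
        (if j = 0 then 2 * curveJetBar cc cc' U 0 0 else
          (2 * π + 1) * curveJetBar cc cc' U 1 0 + (if j = 2 then curveJetBar cc cc' U 2 0 else 0)) *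
        (4 + max 1 (((j - 1).factorial : ℝ) / (8 / 5))) ^ j ≤ twoLegBar G Q U j 0)
    {d ρ : ℝ} (hd : 0 < d)
    (hnear : ∀ K' : TrigPolyC4v, FrameOKDeg R U (klTempScaleIdx β klE0) μ K' → frameDist K K' ≤ d → ∀ θ : ℝ,
      |(klLocalPart L M β U μ K 0 θ - K.eval (klFermiPoint μ K θ)) - (klLocalPart L M β U μ K' 0 θ - K'.eval (klFermiPoint μ K' θ))| ≤
        ρ * frameDist K K')
    (hvK' : ∀ K' : TrigPolyC4v, FrameOKDeg R U (klTempScaleIdx β klE0) μ K' → ∀ θ : ℝ,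
      |klLocalPart L M β U μ K' 0 θ - K'.eval (klFermiPoint μ K' θ)| ≤ curveJetBar cc cc' U 0 0)
    (hfitL : ρ ≤ lipBar G Q U 0) (hfar : 2 * curveJetBar cc cc' U 0 0 ≤ lipBar G Q U 0 * d)
    (hz : ∀ k ∈ klShell L μ K 0, |klFieldStrength L M β U μ K 0 k - 1| ≤ R.cz * |U|)
    {m₁' : ℝ}
    (hm₁' : ∀ q : Momentum, |frameLevel μ K q| ≤ klScale klE0 0 →
      ‖fderiv ℝ (evalM (symInterp L (fun p => klLocSelfEnergyRe L M β U μ K 0 p - K.eval (latticeMomentum L p)))) q‖ ≤ m₁')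
    (hfit1 : m₁' + 4 / 3 * R.Gfr 1 * U ^ 2 ≤ R.cz * |U| * (cDtmin (-1.2) (-0.05) / 2)) :
    TwoLegCoreTD L M hist G P Q R β U μ K 0 := by
  obtain ⟨hA0, hA1, hA2⟩ := hJ.jets_zero
  exact twoLegCoreTD_zero_of_profileData (L := L) (M := M) hR hc hcle hU hUle hβmin hβc hμ hKD hL hist G P Q
    (A := fun k => curveJetBar cc cc' U k 0) hA0 hA1 hA2 hfitS hd hnear hvK' hfitL hfar hz hm₁' hfit1

/-- **`TwoLegCoreTD hist G P Q R … K (n+1)` FROM THE SCALE-`(n+1)` CURVE-JET PREDICATE** (named thresholds): `hJ : TwoLegCurveJetBound L M cc cc' β U μ K (n+1)`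
supplies the three jets of the increment profile; residuals = `hfitS` on the bars, the (E3c) rows and the (E3e) rows of `twoLegCoreTD_succ_of_profileData`. -/
theorem twoLegCoreTD_succ_of_curveJets {R : RenConsts} (hR : ∀ j, 0 ≤ R.Gfr j) {c : ℝ} (hc : 0 < c)
    (hcle : c ≤ klCurveC3 R) {U : ℝ} (hU : 0 < U) (hUle : U ≤ klCurveU0 R) {β : ℝ} (hβmin : klBetaMin ≤ β)
    (hβc : β ≤ Real.exp (c / U ^ 2)) {μ : ℝ} (hμ : μ ∈ klWindowC) {K : TrigPolyC4v} (hKD : FrameOKDeg R U (nScales β) μ K)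
    (hL : klEngL₃ β U ≤ L) (hist : TrigPolyC4v → ℕ → Prop) (G : GeoConsts) (P : SplitConsts) (Q : EngConsts) (n : ℕ)
    {cc cc' : ℕ → ℝ} (hJ : TwoLegCurveJetBound L M cc cc' β U μ K (n + 1))
    (hfitS : ∀ j ≤ 2, (if j = 0 then curveJetBar cc cc' U 0 (n + 1) else 0) +
      (j.factorial : ℝ) ^ 2 * (2 * j.factorial * 1110 * 200 ^ j) *
        (if j = 0 then 2 * curveJetBar cc cc' U 0 (n + 1) else
          (2 * π + 1) * curveJetBar cc cc' U 1 (n + 1) + (if j = 2 then curveJetBar cc cc' U 2 (n + 1) else 0)) *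
        (4 + max 1 (((j - 1).factorial : ℝ) / (8 / 5))) ^ j ≤ twoLegBar G Q U j (n + 1))
    {d ρ : ℝ} (hd : 0 < d)
    (hnear : ∀ K' : TrigPolyC4v, FrameOKDeg R U (klTempScaleIdx β klE0) μ K' → (∀ j < n + 1, hist K' j) → frameDist K K' ≤ d → ∀ θ : ℝ,
      |(klLocalPart L M β U μ K (n + 1) θ - klLocalPart L M β U μ K n θ) -
        (klLocalPart L M β U μ K' (n + 1) θ - klLocalPart L M β U μ K' n θ)| ≤ ρ * frameDist K K')
    (hvK' : ∀ K' : TrigPolyC4v, FrameOKDeg R U (klTempScaleIdx β klE0) μ K' → (∀ j < n + 1, hist K' j) → ∀ θ : ℝ,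
      |klLocalPart L M β U μ K' (n + 1) θ - klLocalPart L M β U μ K' n θ| ≤ curveJetBar cc cc' U 0 (n + 1))
    (hfitL : ρ ≤ lipBar G Q U (n + 1)) (hfar : 2 * curveJetBar cc cc' U 0 (n + 1) ≤ lipBar G Q U (n + 1) * d)
    (hz : ∀ k ∈ klShell L μ K (n + 1), |klFieldStrength L M β U μ K (n + 1) k - 1| ≤ R.cz * |U|)
    {m₁' : ℝ}
    (hm₁' : ∀ q : Momentum, |frameLevel μ K q| ≤ klScale klE0 (n + 1) →
      ‖fderiv ℝ (evalM (symInterp L (fun p => klLocSelfEnergyRe L M β U μ K (n + 1) p - K.eval (latticeMomentum L p)))) q‖ ≤ m₁')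
    (hfit1 : m₁' + 4 / 3 * R.Gfr 1 * U ^ 2 ≤ R.cz * |U| * (cDtmin (-1.2) (-0.05) / 2)) :
    TwoLegCoreTD L M hist G P Q R β U μ K (n + 1) := by
  obtain ⟨hA0, hA1, hA2⟩ := hJ.jets_succ
  exact twoLegCoreTD_succ_of_profileData (L := L) (M := M) hR hc hcle hU hUle hβmin hβc hμ hKD hL hist G P Q n
    (A := fun k => curveJetBar cc cc' U k (n + 1)) hA0 hA1 hA2 hfitS hd hnear hvK' hfitL hfar hz hm₁' hfit1

/-- **Gen-6 stub-keyed, scale `0`, CURVE-JET predicate** (registered binders of 20236: `U ≤ klEngU₀4 P R c`, `klEngGeo5`, `klEngQ5 P R`): what the v4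
composition feeds (M) from `stub_twoLeg_curvature … 0` (parametric constants `cc, cc'`; the `(G,Q)` instance is `cc := klEngGeo5.S`, `cc' := (klEngQ5 P R).S'`). -/
theorem twoLegCoreTD_zero_of_curveJets_stub8 (P : SplitConsts) {R : RenConsts} (hRW : R.WF2) {c : ℝ} (hc : 0 < c)
    (hcle : c ≤ klEngC₃3 P R) {U : ℝ} (hU : 0 < U) (hUle : U ≤ klEngU₀4 P R c) {β : ℝ} (hβmin : klBetaMin ≤ β)
    (hβc : β ≤ Real.exp (c / U ^ 2)) {μ : ℝ} (hμ : μ ∈ klWindowC) {K : TrigPolyC4v} (hKD : FrameOKDeg R U (nScales β) μ K)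
    (hL : klEngL₃ β U ≤ L) (hist : TrigPolyC4v → ℕ → Prop)
    {cc cc' : ℕ → ℝ} (hJ : TwoLegCurveJetBound L M cc cc' β U μ K 0)
    (hfitS : ∀ j ≤ 2, (if j = 0 then curveJetBar cc cc' U 0 0 else 0) +
      (j.factorial : ℝ) ^ 2 * (2 * j.factorial * 1110 * 200 ^ j) *
        (if j = 0 then 2 * curveJetBar cc cc' U 0 0 else
          (2 * π + 1) * curveJetBar cc cc' U 1 0 + (if j = 2 then curveJetBar cc cc' U 2 0 else 0)) *
        (4 + max 1 (((j - 1).factorial : ℝ) / (8 / 5))) ^ j ≤ twoLegBar klEngGeo5 (klEngQ5 P R) U j 0)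
    {d ρ : ℝ} (hd : 0 < d)
    (hnear : ∀ K' : TrigPolyC4v, FrameOKDeg R U (klTempScaleIdx β klE0) μ K' → frameDist K K' ≤ d → ∀ θ : ℝ,
      |(klLocalPart L M β U μ K 0 θ - K.eval (klFermiPoint μ K θ)) - (klLocalPart L M β U μ K' 0 θ - K'.eval (klFermiPoint μ K' θ))| ≤
        ρ * frameDist K K')
    (hvK' : ∀ K' : TrigPolyC4v, FrameOKDeg R U (klTempScaleIdx β klE0) μ K' → ∀ θ : ℝ,
      |klLocalPart L M β U μ K' 0 θ - K'.eval (klFermiPoint μ K' θ)| ≤ curveJetBar cc cc' U 0 0)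
    (hfitL : ρ ≤ lipBar klEngGeo5 (klEngQ5 P R) U 0) (hfar : 2 * curveJetBar cc cc' U 0 0 ≤ lipBar klEngGeo5 (klEngQ5 P R) U 0 * d)
    (hz : ∀ k ∈ klShell L μ K 0, |klFieldStrength L M β U μ K 0 k - 1| ≤ R.cz * |U|)
    {m₁' : ℝ}
    (hm₁' : ∀ q : Momentum, |frameLevel μ K q| ≤ klScale klE0 0 →
      ‖fderiv ℝ (evalM (symInterp L (fun p => klLocSelfEnergyRe L M β U μ K 0 p - K.eval (latticeMomentum L p)))) q‖ ≤ m₁')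
    (hfit1 : m₁' + 4 / 3 * R.Gfr 1 * U ^ 2 ≤ R.cz * |U| * (cDtmin (-1.2) (-0.05) / 2)) :
    TwoLegCoreTD L M hist klEngGeo5 P (klEngQ5 P R) R β U μ K 0 := by
  obtain ⟨hA0, hA1, hA2⟩ := hJ.jets_zero
  exact twoLegCoreTD_zero_of_profileData_stub8 (L := L) (M := M) P hRW hc hcle hU hUle hβmin hβc hμ hKD hL hist
    (A := fun k => curveJetBar cc cc' U k 0) hA0 hA1 hA2 hfitS hd hnear hvK' hfitL hfar hz hm₁' hfit1

/-- **Gen-6 stub-keyed, scale `n + 1`, CURVE-JET predicate** (registered binders of 20236): what the v4 composition feeds (e) from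
`stub_twoLeg_curvature … (n+1)`; the `TwoLegCoreTD`-level content of r2d-p1's `EngineV8.twoLegStepV16_succ_of_curveJets_stub`. -/
theorem twoLegCoreTD_succ_of_curveJets_stub8 (P : SplitConsts) {R : RenConsts} (hRW : R.WF2) {c : ℝ} (hc : 0 < c)
    (hcle : c ≤ klEngC₃3 P R) {U : ℝ} (hU : 0 < U) (hUle : U ≤ klEngU₀4 P R c) {β : ℝ} (hβmin : klBetaMin ≤ β)
    (hβc : β ≤ Real.exp (c / U ^ 2)) {μ : ℝ} (hμ : μ ∈ klWindowC) {K : TrigPolyC4v} (hKD : FrameOKDeg R U (nScales β) μ K)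
    (hL : klEngL₃ β U ≤ L) (hist : TrigPolyC4v → ℕ → Prop) (n : ℕ)
    {cc cc' : ℕ → ℝ} (hJ : TwoLegCurveJetBound L M cc cc' β U μ K (n + 1))
    (hfitS : ∀ j ≤ 2, (if j = 0 then curveJetBar cc cc' U 0 (n + 1) else 0) +
      (j.factorial : ℝ) ^ 2 * (2 * j.factorial * 1110 * 200 ^ j) *
        (if j = 0 then 2 * curveJetBar cc cc' U 0 (n + 1) else
          (2 * π + 1) * curveJetBar cc cc' U 1 (n + 1) + (if j = 2 then curveJetBar cc cc' U 2 (n + 1) else 0)) *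
        (4 + max 1 (((j - 1).factorial : ℝ) / (8 / 5))) ^ j ≤ twoLegBar klEngGeo5 (klEngQ5 P R) U j (n + 1))
    {d ρ : ℝ} (hd : 0 < d)
    (hnear : ∀ K' : TrigPolyC4v, FrameOKDeg R U (klTempScaleIdx β klE0) μ K' → (∀ j < n + 1, hist K' j) → frameDist K K' ≤ d → ∀ θ : ℝ,
      |(klLocalPart L M β U μ K (n + 1) θ - klLocalPart L M β U μ K n θ) -
        (klLocalPart L M β U μ K' (n + 1) θ - klLocalPart L M β U μ K' n θ)| ≤ ρ * frameDist K K')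
    (hvK' : ∀ K' : TrigPolyC4v, FrameOKDeg R U (klTempScaleIdx β klE0) μ K' → (∀ j < n + 1, hist K' j) → ∀ θ : ℝ,
      |klLocalPart L M β U μ K' (n + 1) θ - klLocalPart L M β U μ K' n θ| ≤ curveJetBar cc cc' U 0 (n + 1))
    (hfitL : ρ ≤ lipBar klEngGeo5 (klEngQ5 P R) U (n + 1))
    (hfar : 2 * curveJetBar cc cc' U 0 (n + 1) ≤ lipBar klEngGeo5 (klEngQ5 P R) U (n + 1) * d)
    (hz : ∀ k ∈ klShell L μ K (n + 1), |klFieldStrength L M β U μ K (n + 1) k - 1| ≤ R.cz * |U|)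
    {m₁' : ℝ}
    (hm₁' : ∀ q : Momentum, |frameLevel μ K q| ≤ klScale klE0 (n + 1) →
      ‖fderiv ℝ (evalM (symInterp L (fun p => klLocSelfEnergyRe L M β U μ K (n + 1) p - K.eval (latticeMomentum L p)))) q‖ ≤ m₁')
    (hfit1 : m₁' + 4 / 3 * R.Gfr 1 * U ^ 2 ≤ R.cz * |U| * (cDtmin (-1.2) (-0.05) / 2)) :
    TwoLegCoreTD L M hist klEngGeo5 P (klEngQ5 P R) R β U μ K (n + 1) := by
  obtain ⟨hA0, hA1, hA2⟩ := hJ.jets_succ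
  exact twoLegCoreTD_succ_of_profileData_stub8 (L := L) (M := M) P hRW hc hcle hU hUle hβmin hβc hμ hKD hL hist n
    (A := fun k => curveJetBar cc cc' U k (n + 1)) hA0 hA1 hA2 hfitS hd hnear hvK' hfitL hfar hz hm₁' hfit1

/-! ## §3 Scale `0` with the far value sizes discharged from the predicate at EVERY capped frame -/

/-- **`TwoLegCoreTD hist G P Q R … K 0` WHEN THE SCALE-`0` CURVE-JET PREDICATE HOLDS FOR EVERY DEGREE-CAPPED FRAME** (named thresholds): `hJall`
supplies the base frame's three jets (`K` is capped) AND the far value sizes `hvK'` of every comparison frame (an order-`0` jet of `δ₀^{K′}`).  Residuals =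
`hfitS`, `hd/hnear/hfitL/hfar`, `hz/hm₁'/hfit1`. -/
theorem twoLegCoreTD_zero_of_curveJetsAll {R : RenConsts} (hR : ∀ j, 0 ≤ R.Gfr j) {c : ℝ} (hc : 0 < c)
    (hcle : c ≤ klCurveC3 R) {U : ℝ} (hU : 0 < U) (hUle : U ≤ klCurveU0 R) {β : ℝ} (hβmin : klBetaMin ≤ β)
    (hβc : β ≤ Real.exp (c / U ^ 2)) {μ : ℝ} (hμ : μ ∈ klWindowC) {K : TrigPolyC4v} (hKD : FrameOKDeg R U (nScales β) μ K)
    (hL : klEngL₃ β U ≤ L) (hist : TrigPolyC4v → ℕ → Prop) (G : GeoConsts) (P : SplitConsts) (Q : EngConsts)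
    {cc cc' : ℕ → ℝ} (hJall : ∀ K' : TrigPolyC4v, FrameOKDeg R U (nScales β) μ K' → TwoLegCurveJetBound L M cc cc' β U μ K' 0)
    (hfitS : ∀ j ≤ 2, (if j = 0 then curveJetBar cc cc' U 0 0 else 0) +
      (j.factorial : ℝ) ^ 2 * (2 * j.factorial * 1110 * 200 ^ j) *
        (if j = 0 then 2 * curveJetBar cc cc' U 0 0 else
          (2 * π + 1) * curveJetBar cc cc' U 1 0 + (if j = 2 then curveJetBar cc cc' U 2 0 else 0)) *
        (4 + max 1 (((j - 1).factorial : ℝ) / (8 / 5))) ^ j ≤ twoLegBar G Q U j 0)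
    {d ρ : ℝ} (hd : 0 < d)
    (hnear : ∀ K' : TrigPolyC4v, FrameOKDeg R U (klTempScaleIdx β klE0) μ K' → frameDist K K' ≤ d → ∀ θ : ℝ,
      |(klLocalPart L M β U μ K 0 θ - K.eval (klFermiPoint μ K θ)) - (klLocalPart L M β U μ K' 0 θ - K'.eval (klFermiPoint μ K' θ))| ≤
        ρ * frameDist K K')
    (hfitL : ρ ≤ lipBar G Q U 0) (hfar : 2 * curveJetBar cc cc' U 0 0 ≤ lipBar G Q U 0 * d)
    (hz : ∀ k ∈ klShell L μ K 0, |klFieldStrength L M β U μ K 0 k - 1| ≤ R.cz * |U|)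
    {m₁' : ℝ}
    (hm₁' : ∀ q : Momentum, |frameLevel μ K q| ≤ klScale klE0 0 →
      ‖fderiv ℝ (evalM (symInterp L (fun p => klLocSelfEnergyRe L M β U μ K 0 p - K.eval (latticeMomentum L p)))) q‖ ≤ m₁')
    (hfit1 : m₁' + 4 / 3 * R.Gfr 1 * U ^ 2 ≤ R.cz * |U| * (cDtmin (-1.2) (-0.05) / 2)) :
    TwoLegCoreTD L M hist G P Q R β U μ K 0 :=
  twoLegCoreTD_zero_of_curveJets (L := L) (M := M) hR hc hcle hU hUle hβmin hβc hμ hKD hL hist G P Q (hJall K hKD) hfitS hd hnear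
    (fun K' hK' θ => ((hJall K' hK').jets_zero).1 θ) hfitL hfar hz hm₁' hfit1

/-- **Gen-6 stub-keyed, scale `0`, CURVE-JET predicate at every capped frame** (registered binders of 20236): the (M) composition can produce `hJall`
from `stub_engine_scale0` + `stub_twoLeg_curvature … 0` applied at each `K′` (empty history at scale `0`), after which the (E3c) FAR row needs no
engine input. -/
theorem twoLegCoreTD_zero_of_curveJetsAll_stub8 (P : SplitConsts) {R : RenConsts} (hRW : R.WF2) {c : ℝ} (hc : 0 < c)
    (hcle : c ≤ klEngC₃3 P R) {U : ℝ} (hU : 0 < U) (hUle : U ≤ klEngU₀4 P R c) {β : ℝ} (hβmin : klBetaMin ≤ β)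
    (hβc : β ≤ Real.exp (c / U ^ 2)) {μ : ℝ} (hμ : μ ∈ klWindowC) {K : TrigPolyC4v} (hKD : FrameOKDeg R U (nScales β) μ K)
    (hL : klEngL₃ β U ≤ L) (hist : TrigPolyC4v → ℕ → Prop)
    {cc cc' : ℕ → ℝ} (hJall : ∀ K' : TrigPolyC4v, FrameOKDeg R U (nScales β) μ K' → TwoLegCurveJetBound L M cc cc' β U μ K' 0)
    (hfitS : ∀ j ≤ 2, (if j = 0 then curveJetBar cc cc' U 0 0 else 0) +
      (j.factorial : ℝ) ^ 2 * (2 * j.factorial * 1110 * 200 ^ j) *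
        (if j = 0 then 2 * curveJetBar cc cc' U 0 0 else
          (2 * π + 1) * curveJetBar cc cc' U 1 0 + (if j = 2 then curveJetBar cc cc' U 2 0 else 0)) *
        (4 + max 1 (((j - 1).factorial : ℝ) / (8 / 5))) ^ j ≤ twoLegBar klEngGeo5 (klEngQ5 P R) U j 0)
    {d ρ : ℝ} (hd : 0 < d)
    (hnear : ∀ K' : TrigPolyC4v, FrameOKDeg R U (klTempScaleIdx β klE0) μ K' → frameDist K K' ≤ d → ∀ θ : ℝ,
      |(klLocalPart L M β U μ K 0 θ - K.eval (klFermiPoint μ K θ)) - (klLocalPart L M β U μ K' 0 θ - K'.eval (klFermiPoint μ K' θ))| ≤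
        ρ * frameDist K K')
    (hfitL : ρ ≤ lipBar klEngGeo5 (klEngQ5 P R) U 0) (hfar : 2 * curveJetBar cc cc' U 0 0 ≤ lipBar klEngGeo5 (klEngQ5 P R) U 0 * d)
    (hz : ∀ k ∈ klShell L μ K 0, |klFieldStrength L M β U μ K 0 k - 1| ≤ R.cz * |U|)
    {m₁' : ℝ}
    (hm₁' : ∀ q : Momentum, |frameLevel μ K q| ≤ klScale klE0 0 →
      ‖fderiv ℝ (evalM (symInterp L (fun p => klLocSelfEnergyRe L M β U μ K 0 p - K.eval (latticeMomentum L p)))) q‖ ≤ m₁')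
    (hfit1 : m₁' + 4 / 3 * R.Gfr 1 * U ^ 2 ≤ R.cz * |U| * (cDtmin (-1.2) (-0.05) / 2)) :
    TwoLegCoreTD L M hist klEngGeo5 P (klEngQ5 P R) R β U μ K 0 :=
  twoLegCoreTD_zero_of_curveJets_stub8 (L := L) (M := M) P hRW hc hcle hU hUle hβmin hβc hμ hKD hL hist (hJall K hKD) hfitS hd hnear
    (fun K' hK' θ => ((hJall K' hK').jets_zero).1 θ) hfitL hfar hz hm₁' hfit1

end Summit.HubbardSuperconductivity.HubbardSuperconductivity.Theorems.KLRegimeSplit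

end
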